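import Literature.Dynamics.TopologicalDynamics.ToralExpandingMapsHolderConjugacy
import Literature.AlgebraicGeometry.HodgeTheory.AbelianVarietyExpandingSelfMapsConjugacy
import HarnessLib

/-!
# Conjugacies of expanding self-maps of a complex abelian variety are bi-Hölder in flat coordinates

Lane `lit-hodgefound` (HODGE PATH, Track 2 foundations library; prover seat `lit-hodgefound-p31`, row g25-#3, FILE 2),
in the lineage «dynamics of endomorphisms of abelian varieties».  The lane-side reading of
`Literature/Dynamics/TopologicalDynamics/ToralExpandingMapsHolderConjugacy.lean` (FILE 1 of the row: Katok–Hasselblatt's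
Theorem 19.1.2 in the expanding case — conjugacies between expanding maps of `(ℝ/ℤ)^ι` are bi-Hölder) on a complex
abelian variety through a group uniformisation `φ : X = E/Φ(ℤ^ι) ≃ A(ℂ)` (✔ `complexAbelianVariety_torusUniformised`):
for the self-maps `g(P) = f(ℂ)(P) · φ(E′(φ⁻¹P) mod Λ)` of ✔ `AbelianVarietyExpandingSelfMapsConjugacy.lean` (`E′`
Lipschitz in the flat coordinates, flat lift expanding), EVERY conjugacy `h` of `A(ℂ)` with `h ∘ g = f(ℂ) ∘ h` is,
read in the flat coordinates `(ℝ/ℤ)^ι` of `φ`, Hölder continuous together with its inverse.  (`A(ℂ)` carries no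
preferred metric; Hölder continuity is a statement in the flat chart, where it does not depend on the choice of the
flat metric.)

## Main statements (theorems only; no definition, no named fact)

* `AbelianVariety.selfMap_apply_uniformisation` — `g(φ(y)) = φ(T_M y + E′(y) mod ℤ^ι)`: in flat coordinates `g` is the
  torus map `T_M + E′ mod ℤ^ι`.
* **`AbelianVariety.exists_holderWith_of_conj_of_expanding_lift`** — every conjugacy `h : A(ℂ) ≃ A(ℂ)`,
  `h ∘ g = f(ℂ) ∘ h`, is bi-Hölder in flat coordinates (`φ⁻¹ ∘ h ∘ φ` and `φ⁻¹ ∘ h⁻¹ ∘ φ` are `HolderWith`).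
* `AbelianVariety.exists_biHolder_homeomorph_conj_of_expanding_lift` — Shub's conjugacy of ✔ g24-#5 on `A(ℂ)` exists
  AND is bi-Hölder in flat coordinates.

## References

* [KatokHasselblatt1995] A. Katok, B. Hasselblatt, *Introduction to the Modern Theory of Dynamical Systems*, CUP
  (1995), §19.1 b Theorem 19.1.2 (galaxy panama:410555923824727 chars 1822000–1840000); §2.4 Theorem 2.4.6.
* [Shub1970ExpandingMaps] M. Shub, *Expanding maps*, Proc. Sympos. Pure Math. XIV (1970), Theorems 2–3 (held text
  book:chern1970-global-analysis chunk p0329).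
* [Lange2023AbelianVarietiesComplex] H. Lange, *Abelian Varieties over the Complex Numbers*, Springer (2023), §1.1.2
  Prop. 1.1.6 (PDF p. 19).
-/

noncomputable section

open Set Function Filter Topology
open CategoryTheory
open Literature.Dynamics.TopologicalDynamics
open Literature.Dynamics.Ergodic
open Literature.NumberTheory.Transcendental (IsAnalytification)
open Literature.AlgebraicGeometry.Motives (ComplexPoints AbelianVariety AlgPoints specOver)
open scoped NNReal Matrix

namespace Literature.AlgebraicGeometry.HodgeTheory

open Literature.Geometry.Kaehler

section Holder

variable (A : AbelianVariety ℂ) (f : A ⟶ A) {ι : Type} [Fintype ι] [DecidableEq ι] {E : Type}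
  [NormedAddCommGroup E] [NormedSpace ℂ E] [FiniteDimensional ℂ E] {Φ : (ι → ℝ) ≃L[ℝ] E}
  {φ : ComplexTorus Φ → ComplexPoints A.X} (hφ : IsAnalytification E A.X A.dim φ)
  (hadd : ∀ x y, φ (x + y) = φ x * φ y)

include hφ in
omit [DecidableEq ι] in
/-- `φ ∘ φ⁻¹ = id`. [folklore] -/
private theorem apply_homeomorph_symm (P : A.Points ℂ) : φ (hφ.homeomorph.symm P) = P := by
  have h := hφ.homeomorph.apply_symm_apply P
  rwa [IsAnalytification.coe_homeomorph] at h

include hφ in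
omit [DecidableEq ι] in
/-- `φ⁻¹ ∘ φ = id`. [folklore] -/
private theorem homeomorph_symm_apply (z : ComplexTorus Φ) : hφ.homeomorph.symm (φ z) = z := by
  have h := hφ.homeomorph.symm_apply_apply z
  rwa [IsAnalytification.coe_homeomorph] at h

omit [DecidableEq ι] in
include hφ hadd in
/-- **In flat coordinates the self-map `g(P) = f(ℂ)(P) · φ(E′(φ⁻¹P) mod Λ)` is the torus map `T_M + E′ mod ℤ^ι`**:
`g(φ(y)) = φ(T_M y + E′(y) mod ℤ^ι)`. [cite: Lange2023AbelianVarietiesComplex, §1.1.2 Prop. 1.1.6 (PDF p. 19)]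
[cite: Shub1970ExpandingMaps, Example 2 (held text chunk p0328)] -/
theorem AbelianVariety.selfMap_apply_uniformisation (M : Matrix ι ι ℤ)
    (hM : ∀ t, φ (ComplexTorus.mapMatrix Φ Φ M t) = AlgPoints.mapContinuous (L := ℂ) f.hom.hom.hom (φ t))
    (E' : UnitAddTorus ι → ι → ℝ) (y : UnitAddTorus ι) :
    AlgPoints.mapContinuous (L := ℂ) f.hom.hom.hom (φ ((ComplexTorus.toRealTorus Φ).symm y)) *
        φ ((ComplexTorus.toRealTorus Φ).symm fun i ↦
          ((E' (ComplexTorus.toRealTorus Φ (hφ.homeomorph.symm (φ ((ComplexTorus.toRealTorus Φ).symm y)))) i : ℝ) :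
            UnitAddCircle)) =
      φ ((ComplexTorus.toRealTorus Φ).symm
        ((fun i ↦ ∑ j, M i j • y j) + fun i ↦ ((E' y i : ℝ) : UnitAddCircle))) := by
  rw [homeomorph_symm_apply A hφ, Homeomorph.apply_symm_apply,
    show (ComplexTorus.toRealTorus Φ).symm ((fun i ↦ ∑ j, M i j • y j) + fun i ↦ ((E' y i : ℝ) : UnitAddCircle)) =
      ComplexTorus.mapMatrix Φ Φ M ((ComplexTorus.toRealTorus Φ).symm y) +
        (ComplexTorus.toRealTorus Φ).symm (fun i ↦ ((E' y i : ℝ) : UnitAddCircle)) from rfl, hadd, hM]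

include hφ hadd in
/-- **Katok–Hasselblatt's Theorem 19.1.2 for the expanding self-maps of a complex abelian variety, in flat
coordinates.**  Let `φ : E/Φ(ℤ^ι) ≃ A(ℂ)` be a group uniformisation, `f` an endomorphism with matrix `M` in it,
`g(P) = f(ℂ)(P) · φ(E′(φ⁻¹P) mod Λ)` with `E′ : (ℝ/ℤ)^ι → ℝ^ι` LIPSCHITZ and flat lift `G(x) = M_ℝ x + E′(x mod ℤ^ι)`
expanding (`c₀ λⁿ ‖x − y‖ ≤ ‖Gⁿ(x) − Gⁿ(y)‖`, `c₀ > 0`, `λ > 1`).  Then EVERY homeomorphism `h` of `A(ℂ)` with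
`h ∘ g = f(ℂ) ∘ h` is bi-Hölder in the flat coordinates: `φ⁻¹ ∘ h ∘ φ` and `φ⁻¹ ∘ h⁻¹ ∘ φ` are Hölder continuous maps
of `(ℝ/ℤ)^ι`.
[cite: KatokHasselblatt1995, §19.1 b Theorem 19.1.2 (galaxy panama:410555923824727 chars 1822000–1840000)]
[cite: Lange2023AbelianVarietiesComplex, §1.1.2 Prop. 1.1.6 (PDF p. 19)] -/
theorem AbelianVariety.exists_holderWith_of_conj_of_expanding_lift (M : Matrix ι ι ℤ)
    (hM : ∀ t, φ (ComplexTorus.mapMatrix Φ Φ M t) = AlgPoints.mapContinuous (L := ℂ) f.hom.hom.hom (φ t))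
    {E' : UnitAddTorus ι → ι → ℝ} {KE : ℝ≥0} (hE : LipschitzWith KE E') {G : (ι → ℝ) → ι → ℝ}
    (hG : ∀ x, G x = (M.map (Int.cast : ℤ → ℝ)) *ᵥ x + E' (fun i ↦ ((x i : ℝ) : UnitAddCircle)))
    {c₀ lam : ℝ} (hc₀ : 0 < c₀) (hlam : 1 < lam)
    (hGexp : ∀ (n : ℕ) (x y : ι → ℝ), c₀ * lam ^ n * ‖x - y‖ ≤ ‖G^[n] x - G^[n] y‖)
    (h : A.Points ℂ ≃ₜ A.Points ℂ)
    (hh : ∀ P, h (AlgPoints.mapContinuous (L := ℂ) f.hom.hom.hom P *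
        φ ((ComplexTorus.toRealTorus Φ).symm fun i ↦
          ((E' (ComplexTorus.toRealTorus Φ (hφ.homeomorph.symm P)) i : ℝ) : UnitAddCircle))) =
      AlgPoints.mapContinuous (L := ℂ) f.hom.hom.hom (h P)) :
    ∃ (K α K' α' : ℝ≥0), 0 < α ∧ 0 < α' ∧
      HolderWith K α (fun x : UnitAddTorus ι ↦
        ComplexTorus.toRealTorus Φ (hφ.homeomorph.symm (h (φ ((ComplexTorus.toRealTorus Φ).symm x))))) ∧
      HolderWith K' α' (fun x : UnitAddTorus ι ↦
        ComplexTorus.toRealTorus Φ (hφ.homeomorph.symm (h.symm (φ ((ComplexTorus.toRealTorus Φ).symm x))))) := by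
  have hexp := ToralExpandingConjugacy.lt_norm_of_mem_roots_of_expanding_lift_zero M hG hc₀ hlam hGexp
  have hφc : Continuous φ := hφ.isHomeomorph.continuous
  -- the torus maps `T = T_M` and `g_t = T + E′ mod ℤ^ι`
  have hT : ∀ x : UnitAddTorus ι, (fun x i ↦ ∑ j, M i j • x j : UnitAddTorus ι → UnitAddTorus ι) x =
      (fun i ↦ ∑ j, M i j • x j) + (0 : UnitAddTorus ι) := fun x ↦ (add_zero _).symm
  have hA0 : (fun i ↦ (((0 : ι → ℝ) i : ℝ) : UnitAddCircle)) = (0 : UnitAddTorus ι) := by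
    funext i; simp only [Pi.zero_apply, AddCircle.coe_zero]
  have hG' : ∀ x, G x = (M.map (Int.cast : ℤ → ℝ)) *ᵥ x + 0 + E' (fun i ↦ ((x i : ℝ) : UnitAddCircle)) := fun x ↦ by
    rw [add_zero]; exact hG x
  have hgY := AbelianVariety.selfMap_apply_uniformisation A f hφ hadd M hM E'
  -- the inverse conjugacy identity
  have hh' : ∀ P, h.symm (AlgPoints.mapContinuous (L := ℂ) f.hom.hom.hom P) =
      AlgPoints.mapContinuous (L := ℂ) f.hom.hom.hom (h.symm P) *
        φ ((ComplexTorus.toRealTorus Φ).symm fun i ↦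
          ((E' (ComplexTorus.toRealTorus Φ (hφ.homeomorph.symm (h.symm P))) i : ℝ) : UnitAddCircle)) := fun P ↦
    h.injective (by rw [hh, h.apply_symm_apply, h.apply_symm_apply])
  -- `ψ = φ⁻¹ ∘ h ∘ φ` conjugates `g_t` to `T`
  have hψ : ∀ x : UnitAddTorus ι,
      ComplexTorus.toRealTorus Φ (hφ.homeomorph.symm (h (φ ((ComplexTorus.toRealTorus Φ).symm
        ((fun x i ↦ ∑ j, M i j • x j : UnitAddTorus ι → UnitAddTorus ι) x +
          fun i ↦ ((E' x i : ℝ) : UnitAddCircle)))))) =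
      (fun x i ↦ ∑ j, M i j • x j : UnitAddTorus ι → UnitAddTorus ι)
        (ComplexTorus.toRealTorus Φ (hφ.homeomorph.symm (h (φ ((ComplexTorus.toRealTorus Φ).symm x))))) := by
    intro x
    change _ = ComplexTorus.toRealTorus Φ (ComplexTorus.mapMatrix Φ Φ M
      (hφ.homeomorph.symm (h (φ ((ComplexTorus.toRealTorus Φ).symm x)))))
    congr 1
    rw [← hgY, hh, ← homeomorph_symm_apply A hφ (ComplexTorus.mapMatrix Φ Φ M _), hM, apply_homeomorph_symm A hφ]
  -- `ψ' = φ⁻¹ ∘ h⁻¹ ∘ φ` conjugates `T` to `g_t`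
  have hψ' : ∀ x : UnitAddTorus ι,
      ComplexTorus.toRealTorus Φ (hφ.homeomorph.symm (h.symm (φ ((ComplexTorus.toRealTorus Φ).symm
        ((fun x i ↦ ∑ j, M i j • x j : UnitAddTorus ι → UnitAddTorus ι) x))))) =
      (fun x i ↦ ∑ j, M i j • x j : UnitAddTorus ι → UnitAddTorus ι)
          (ComplexTorus.toRealTorus Φ (hφ.homeomorph.symm (h.symm (φ ((ComplexTorus.toRealTorus Φ).symm x))))) +
        fun i ↦ ((E' (ComplexTorus.toRealTorus Φ (hφ.homeomorph.symm (h.symm (φ ((ComplexTorus.toRealTorus Φ).symm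
          x))))) i : ℝ) : UnitAddCircle) := by
    intro x
    set y : UnitAddTorus ι :=
      ComplexTorus.toRealTorus Φ (hφ.homeomorph.symm (h.symm (φ ((ComplexTorus.toRealTorus Φ).symm x)))) with hy
    have hQ : h.symm (φ ((ComplexTorus.toRealTorus Φ).symm x)) = φ ((ComplexTorus.toRealTorus Φ).symm y) := by
      rw [hy, Homeomorph.symm_apply_apply, apply_homeomorph_symm A hφ]
    change ComplexTorus.toRealTorus Φ (hφ.homeomorph.symm (h.symm (φ (ComplexTorus.mapMatrix Φ Φ M
      ((ComplexTorus.toRealTorus Φ).symm x))))) = _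
    rw [hM, hh', hQ, hgY, homeomorph_symm_apply A hφ, Homeomorph.apply_symm_apply]
  -- Theorem 19.1.2 on the torus, both directions
  obtain ⟨K, α, hα, hH⟩ := ToralExpandingHolder.exists_holderWith_of_semiconj_affine M 0 hT hexp hE
    (g := fun x ↦ (fun x i ↦ ∑ j, M i j • x j : UnitAddTorus ι → UnitAddTorus ι) x +
      fun i ↦ ((E' x i : ℝ) : UnitAddCircle)) (fun _ ↦ rfl)
    (h := fun x ↦ ComplexTorus.toRealTorus Φ (hφ.homeomorph.symm (h (φ ((ComplexTorus.toRealTorus Φ).symm x)))))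
    ((ComplexTorus.toRealTorus Φ).continuous.comp (hφ.homeomorph.symm.continuous.comp (h.continuous.comp
      (hφc.comp (ComplexTorus.toRealTorus Φ).symm.continuous)))) hψ
  obtain ⟨K', α', hα', hH'⟩ := ToralExpandingHolder.exists_holderWith_of_semiconj_expanding M 0 hT hE
    (g := fun x ↦ (fun x i ↦ ∑ j, M i j • x j : UnitAddTorus ι → UnitAddTorus ι) x +
      fun i ↦ ((E' x i : ℝ) : UnitAddCircle)) (fun _ ↦ rfl) hA0 hG' hc₀ hlam hGexp
    (ψ := fun x ↦ ComplexTorus.toRealTorus Φ (hφ.homeomorph.symm (h.symm (φ ((ComplexTorus.toRealTorus Φ).symm x)))))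
    ((ComplexTorus.toRealTorus Φ).continuous.comp (hφ.homeomorph.symm.continuous.comp (h.symm.continuous.comp
      (hφc.comp (ComplexTorus.toRealTorus Φ).symm.continuous)))) hψ'
  exact ⟨K, α, K', α', hα, hα', hH, hH'⟩

include hφ hadd in
/-- **Shub's conjugacy on `A(ℂ)` is bi-Hölder in flat coordinates**: under the hypotheses of
`AbelianVariety.exists_holderWith_of_conj_of_expanding_lift` there IS a homeomorphism `h` of `A(ℂ)` with
`h ∘ g = f(ℂ) ∘ h` (✔ `AbelianVariety.exists_homeomorph_conj_of_expanding_lift`), and it is bi-Hölder in the flat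
coordinates of `φ`.
[cite: KatokHasselblatt1995, §19.1 b Theorem 19.1.2 and §2.4 Theorem 2.4.6 (galaxy panama:410555923824727 chars 1822000–1840000, 366000–384000)]
[cite: Shub1970ExpandingMaps, Theorems 2–3 (held text chunk p0329)] -/
theorem AbelianVariety.exists_biHolder_homeomorph_conj_of_expanding_lift (M : Matrix ι ι ℤ)
    (hM : ∀ t, φ (ComplexTorus.mapMatrix Φ Φ M t) = AlgPoints.mapContinuous (L := ℂ) f.hom.hom.hom (φ t))
    {E' : UnitAddTorus ι → ι → ℝ} {KE : ℝ≥0} (hE : LipschitzWith KE E') {G : (ι → ℝ) → ι → ℝ}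
    (hG : ∀ x, G x = (M.map (Int.cast : ℤ → ℝ)) *ᵥ x + E' (fun i ↦ ((x i : ℝ) : UnitAddCircle)))
    {c₀ lam : ℝ} (hc₀ : 0 < c₀) (hlam : 1 < lam)
    (hGexp : ∀ (n : ℕ) (x y : ι → ℝ), c₀ * lam ^ n * ‖x - y‖ ≤ ‖G^[n] x - G^[n] y‖) :
    ∃ (h : A.Points ℂ ≃ₜ A.Points ℂ) (K α K' α' : ℝ≥0), 0 < α ∧ 0 < α' ∧
      (∀ P, h (AlgPoints.mapContinuous (L := ℂ) f.hom.hom.hom P *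
        φ ((ComplexTorus.toRealTorus Φ).symm fun i ↦
          ((E' (ComplexTorus.toRealTorus Φ (hφ.homeomorph.symm P)) i : ℝ) : UnitAddCircle))) =
        AlgPoints.mapContinuous (L := ℂ) f.hom.hom.hom (h P)) ∧
      HolderWith K α (fun x : UnitAddTorus ι ↦
        ComplexTorus.toRealTorus Φ (hφ.homeomorph.symm (h (φ ((ComplexTorus.toRealTorus Φ).symm x))))) ∧
      HolderWith K' α' (fun x : UnitAddTorus ι ↦
        ComplexTorus.toRealTorus Φ (hφ.homeomorph.symm (h.symm (φ ((ComplexTorus.toRealTorus Φ).symm x))))) := by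
  obtain ⟨h, hh⟩ := AbelianVariety.exists_homeomorph_conj_of_expanding_lift A f hφ hadd M hM hE.continuous hG hc₀
    hlam hGexp
  obtain ⟨K, α, K', α', hα, hα', hH, hH'⟩ :=
    AbelianVariety.exists_holderWith_of_conj_of_expanding_lift A f hφ hadd M hM hE hG hc₀ hlam hGexp h hh
  exact ⟨h, K, α, K', α', hα, hα', hh, hH, hH'⟩

end Holder

end Literature.AlgebraicGeometry.HodgeTheory
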